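import Literature.IUT.HodgeArakelov.ThetaEvaluationSettingAtModelTate
import Literature.AnabelianGeometry.EtaleTheta.Discharge.Sec1InversionEtaDdSign
import Literature.AnabelianGeometry.EtaleTheta.ThetaKummerInversionTransport
import HarnessLib

/-!
# [IUTchII] Prop 2.2 (ii)′ at the model — the class-level inversion binder `h14orbit` (GAP row D-G-w4d010-2f)
# PRODUCED from abc-iut-L2-t1's CLASS-LEVEL sign theorem for inversion automorphisms ([EtTh] Prop 1.5 (iii) + (ii)),
# WITHOUT a function carrier on `ι` (proof-only knit; node IUTchII:Prop2.2(ii), twin input for IUTchII:Prop3.1(i)/Cor3.5(ii))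

S. Mochizuki, *Inter-universal Teichmüller theory II*, kurims manuscript (Dec. 2020) §2, Prop. 2.2 (ii) p. 66 l. 55–61
(«together with the condition of invariance with respect to `ι` [cf. [EtTh], Proposition 1.4, (ii); the proof of [EtTh],
Theorem 1.6, (iii)], determines a specific `μ_{2l}`- (respectively, `μ (= M^μ_TM(Π_v))`-) orbit»; claim key `Mochizuki2012`, DISPUTED,
D-0012)
[claim: Mochizuki2012, status: disputed] (IUTchII §2 Prop 2.2 (ii), kurims p.66), Rmk. 2.1.1 (i) p. 65 («the vertex
labeled `0` is fixed by `ι_X`» — the POINTED inversion); S. Mochizuki, *The étale theta function and its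
Frobenioid-theoretic manifestations* [EtTh], Publ. RIMS **45** (2009) (refereed): Prop. 1.5 (iii) PRIMS PDF p. 23
l. 84–92 («any inversion automorphism `ι` … fixes `η̈^Θ + log(O^×_K̈)`»), Prop. 1.5 (ii) p. 23, Prop. 1.4 (ii) p. 22
(«`Θ̈(−Ü) = −Θ̈(Ü)`»), Thm. 1.6 (iii) p. 24–25 [cite: MochizukiEtTh2009, Prop 1.5 (iii) p.23].

Cell `abc-iut`, seat abc-iut-w4-d010 (gen 13; lineage of record of the IUTchII:Prop2.2(ii) closers p417690 / p430763 /
p457679 `ThetaEvaluationSettingModelOfOrbitLift` and the lift transport p458522). PROOF-ONLY companion: NO definition,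
NO `Prop` fact, NO instance; every input consumed BY NAME; nothing landed is edited or restated.

STATE OF RECORD. The closers of the `μ_{2l}`-clause of IUTchII:Prop2.2(ii) at `D := etaleThetaDataOfSetting′`
(`prop22_ii'_model_of_inversion_of_prop15_of_origin_orbit`, p457679; transport-currency junction
`prop22_ii'_model_of_transport_conj_of_prop15_of_origin`, abc-iut-w5-d072 p457878) carry ONE class-level binder about the
inversion — `h14orbit : ∃ τ₀ ∈ Π^tp_X̲̲ ∩ Π^tp_Y, ι_*(η̈^Θ|_{Π^tp_Ÿ̲̲}) = τ₀ · η̈^Θ|_{Π^tp_Ÿ̲̲}` (GAP-LEDGER D-G-w4d010-2f) —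
produced so far only UNDER A FUNCTION CARRIER ON `ι` (abc-iut-L2-t12 p465052 `h14orbit_of_thetaKummer`, binders
`ιFn/hιFn/hΛ/hιθ`, whose joint instance at the tree's models is EMPTY: abc-iut-w5-d125 p469482/p471544).
abc-iut-L2-t1 (p469731/p471284, `Discharge/Sec1InversionEtaDdSign.lean`) proved at the CLASS level, for `ι` presented
through the root predicate `IsInversionAut ι` with the inversion clause `InvClauses` of [EtTh] Prop. 1.5 (iii):
`ι_* η̈^Θ = η̈^Θ ∨ ι_* η̈^Θ = κ(−1)·η̈^Θ` (`InvClauses.transport_etaDd_eq_or`), GRANTED Prop. 1.5 (ii) (F-2503, which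
discharges «`ι` fixes the Kummer classes of constants») and the POINTEDNESS clause (h_sq) «`ι² = Ad(δ)` with
`δ ∈ Π^tp_Ÿ`» — and that this is sharp (`transport_etaDd_mem_orbit_iff_sq_mem_GtpYdd`).

THIS FILE knits the two: the consumer's binder `h14orbit` — VERBATIM — is a THEOREM of
{`IsInversionAut ι` + theta companion `c`, `InvClauses E _ c` (⟸ `Prop15iiiInvAnchored E` + ONE anchored cusp of `Ÿ`
over the component labelled `0` fixed by `ι`), `Compat`, `Prop15ii` (F-2503), (h_sq), and the class-level DECK-SIGN
clause «`ε · η̈^Θ = κ(−1)·η̈^Θ`» for the deck transformations `ε ∈ (Π^tp_X̲̲ ∩ Π^tp_Y) ∖ Π^tp_Ÿ` ([EtTh] Prop. 1.4 (ii)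
«`Θ̈(−Ü) = −Θ̈(Ü)`» read on classes; itself a theorem of the function-level DECK identity alone by abc-iut-L2-t1's
`EtaleThetaData.conj_etaDd_eq_of_deck_of_thetaKummer` — the half of the function-level package NOT touched by
abc-iut-w5-d125's no-go, which concerns the `ι`-half)}; no statement about `ι` acting on functions remains.
* §1 `ThetaSetting.InvClauses.exists_mem_mem_GtpY_transport_etaDd_eq_conj_of_prop15ii` — abc-iut-L2-t1's orbit form with
  the witness kept INSIDE a given subgroup `H ∋ ε` (`τ₀ ∈ {1, ε}`); `EtaleThetaData.DoubleUnderline.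
  exists_mem_Huu_mem_GtpY_transport_etaDd_eq_conj_of_invClauses` — the case `H := Π^tp_X̲̲` (the deck element of
  `Ÿ̲̲ → Y̲̲` exists under `Sec2Hyps`, abc-iut-w5-d125 / abc-iut-L2-t12 `exists_mem_Huu_mem_GtpY_not_mem_GtpYdd`), i.e. the
  [EtTh] Thm. 1.6 (iii)-currency statement `∃ τ₀ ∈ Π^tp_X̲̲, τ₀ ∈ Π^tp_Y ∧ transport c h η̈^Θ = conj τ₀ η̈^Θ`;
  `…_of_thetaKummerDeck` — deck-sign clause fed from the function-level deck identity.
* §2 `EtaleThetaDataOfSetting.h14orbit_of_invClauses` — THE BINDER OF RECORD (shape of p457679 / p465052) from the list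
  above (junction abc-iut-w5-d072 `autMap_comap_eq_comap_transport` = abc-iut-L2-t2 `transport_eq_autMap` +
  abc-iut-w4-d014 `ContH1.comap_conj`); `…_of_prop15iiiInvAnchored` (the [EtTh] Prop. 1.5 (iii) predicate + cusp datum
  in place of `InvClauses`).
* §3 `prop22_ii'_model_of_invClauses_of_prop15_of_origin` / `…_of_prop15iiiInvAnchored_of_prop15_of_origin` /
  `…_of_invClauses_of_thetaKummerDeck_of_prop15_of_origin` — IUTchII:Prop2.2(ii)′ at the model with `h14orbit` GONE:
  residual BY NAME = model data (`C`, `hC`, `hS`, (H1) `hchar`, `S`, `eS`, `hl`, `Dec`) · the inversion as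
  {`IsInversionAut ι`, `ι(Π^tp_X̲̲) = Π^tp_X̲̲`, companion `c`, `InvClauses` | `Prop15iiiInvAnchored` + cusp, (h_sq)} ·
  the deck-sign clause · F-2498 `IsEtThOrigin`, F-0591 `Prop15iii`, F-2503 `Prop15ii`. The `toLZ`-generator `γ`, the
  deck element `ε`, `hZ` (`IsInversionAut.toZ_apply`) and `hβ` (`IsInversionAut.thetaIso_apply_eq_self`: `ι^Θ = +1` on
  `Δ_Θ`) of the older binder lists are THEOREMS here.
The same `h14orbit_of_invClauses` term feeds the IUTchII:Prop3.1(i)/Cor3.5(ii) consumers of record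
(`rootLevel_inputs_of_classLevel_orbit`, `EtaleLevels.horb_/hroots_toRecord_inversion_of_classLevel_orbit`, p457998)
by `obtain` — not restated here (holder of record abc-iut-w5-d169).

HONEST FRAMING: [EtTh] is refereed and undisputed; this is a composition of landed theorems; `InvClauses` /
`Prop15iiiInvAnchored` are abc-iut-L2-t1's post-freeze typings of the PRINTED inversion clause of [EtTh] Prop. 1.5 (iii)
(not FACT-LIST rows) and stay hypotheses BY NAME; (h_sq) is print's pointedness ([IUTchII] Rmk. 2.1.1 (i): `δ = 1`);
semi-synthetic models elsewhere are consistency evidence only; nothing here bears on or takes a side on [IUTchIII]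
Cor. 3.12; typed ≠ proved; discharged-modulo-named-inputs ≠ proved outright. Universe `Type` as in `Setting.lean`.
-/

noncomputable section

/-! ## §1. [EtTh] Thm. 1.6 (iii) currency: the orbit form with the witness inside a prescribed subgroup -/

namespace Literature.AnabelianGeometry.EtaleTheta

namespace ThetaSetting

open Literature.AnabelianGeometry.SemiGraphs

variable {p : ℕ} [Fact p.Prime] {D : ThetaSetting p}

/-- **abc-iut-L2-t1's orbit form with the witness INSIDE a given subgroup `H`**: for an inversion automorphism `ι`
(`IsInversionAut`, theta companion `cι`) satisfying the inversion clause of [EtTh] Prop. 1.5 (iii) (`InvClauses`),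
GRANTED `Compat` + Prop. 1.5 (ii) and (h_sq) `ι² = Ad(δ)`, `δ ∈ Π^tp_Ÿ`: if some `ε ∈ H ∩ Π^tp_Y` satisfies the class-level
deck-sign identity `ε · η̈^Θ = κ(−1)·η̈^Θ`, then `transport_ι(η̈^Θ) = τ₀ · η̈^Θ` for some `τ₀ ∈ H ∩ Π^tp_Y` (namely
`τ₀ ∈ {1, ε}`, by `InvClauses.transport_etaDd_eq_or`). [cite: MochizukiEtTh2009, Thm 1.6 (iii) p.25] -/
theorem InvClauses.exists_mem_mem_GtpY_transport_etaDd_eq_conj_of_prop15ii [D.GtpYdd.Normal] {E : D.EtaleThetaData}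
    {ι : D.PiTemp ≃ₜ* D.PiTemp} {hι : D.IsInversionAut ι} {cι : ThetaCompanion ι} (h : InvClauses E hι cι)
    (hC : D.Compat) (h15ii : Prop15ii E.toKummerData hC)
    {δ : D.PiTemp} (hδYdd : δ ∈ D.GtpYdd) (hδ : ∀ x, ι (ι x) = δ * x * δ⁻¹)
    (H : Subgroup D.PiTemp) {ε : D.PiTemp} (hεH : ε ∈ H) (hε : ε ∈ D.GtpY)
    (hdeck : ContH1.conj D.toTheta D.DeltaTheta ε E.etaDd =
      D.inflTheta D.GtpYdd (E.kumYdd (E.toKddHat (-1))) * E.etaDd) :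
    ∃ τ₀ ∈ H, τ₀ ∈ D.GtpY ∧ transport cι hι.thm16i E.etaDd = ContH1.conj D.toTheta D.DeltaTheta τ₀ E.etaDd := by
  rcases h.transport_etaDd_eq_or (hι.transport_infl_kumYdd_eq_self cι E.toKummerData hC h15ii) hδYdd hδ with hT | hT
  · exact ⟨1, one_mem H, one_mem _, by rw [hT, ContH1.conj_one_apply]⟩
  · exact ⟨ε, hεH, hε, by rw [hT, hdeck]⟩

namespace EtaleThetaData.DoubleUnderline

variable {E : D.EtaleThetaData} {l : ℕ} (C : E.DoubleUnderline l)

/-- **[EtTh] Thm. 1.6 (iii) at `γ := ι`, ORBIT FORM inside `Π^tp_X̲̲`, from the CLASS-LEVEL inversion data**: for an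
`X̲̲`-choice `C` (under `Sec2Hyps`, so that the deck transformation of `Ÿ̲̲ → Y̲̲` exists inside `Π^tp_X̲̲`), an inversion
automorphism `ι` with companion `cι` and inversion clause `InvClauses`, `Compat` + Prop. 1.5 (ii), (h_sq), and the
class-level deck-sign clause for the deck transformations in `Π^tp_X̲̲`: `∃ τ₀ ∈ Π^tp_X̲̲, τ₀ ∈ Π^tp_Y ∧
transport_ι(η̈^Θ) = τ₀ · η̈^Θ`. [cite: MochizukiEtTh2009, Thm 1.6 (iii) p.25] -/
theorem exists_mem_Huu_mem_GtpY_transport_etaDd_eq_conj_of_invClauses [D.GtpYdd.Normal] (hS : D.Sec2Hyps)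
    {ι : D.PiTemp ≃ₜ* D.PiTemp} {hι : D.IsInversionAut ι} {cι : ThetaCompanion ι} (h : InvClauses E hι cι)
    (hC : D.Compat) (h15ii : Prop15ii E.toKummerData hC)
    {δ : D.PiTemp} (hδYdd : δ ∈ D.GtpYdd) (hδ : ∀ x, ι (ι x) = δ * x * δ⁻¹)
    (hdeck : ∀ ε ∈ C.Huu, ε ∈ D.GtpY → ε ∉ D.GtpYdd →
      ContH1.conj D.toTheta D.DeltaTheta ε E.etaDd = D.inflTheta D.GtpYdd (E.kumYdd (E.toKddHat (-1))) * E.etaDd) :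
    ∃ τ₀ ∈ C.Huu, τ₀ ∈ D.GtpY ∧ transport cι hι.thm16i E.etaDd = ContH1.conj D.toTheta D.DeltaTheta τ₀ E.etaDd := by
  obtain ⟨ε, hεH, hε₁, hε₂⟩ := C.exists_mem_Huu_mem_GtpY_not_mem_GtpYdd hS
  exact h.exists_mem_mem_GtpY_transport_etaDd_eq_conj_of_prop15ii hC h15ii hδYdd hδ C.Huu hεH hε₁
    (hdeck ε hεH hε₁ hε₂)

/-- The same with the class-level deck-sign clause FED FROM THE FUNCTION LEVEL — the deck identity «`Θ̈(−Ü) = −Θ̈(Ü)`»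
([EtTh] Prop. 1.4 (ii)) on a theta-Kummer input `T` with `η̈^Θ = κ(Θ̈)` and `ConstCompat` (abc-iut-L2-t1's
`EtaleThetaData.conj_etaDd_eq_of_deck_of_thetaKummer` over abc-iut-w5-d125's `conj_kummerTheta_of_deck`); no statement
about `ι` acting on functions is used. [cite: MochizukiEtTh2009, Prop 1.4 (ii) p.22] -/
theorem exists_mem_Huu_mem_GtpY_transport_etaDd_eq_conj_of_invClauses_of_thetaKummerDeck [D.GtpYdd.Normal]
    (hS : D.Sec2Hyps) {ι : D.PiTemp ≃ₜ* D.PiTemp} {hι : D.IsInversionAut ι} {cι : ThetaCompanion ι}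
    (h : InvClauses E hι cι) (hC : D.Compat) (h15ii : Prop15ii E.toKummerData hC)
    {δ : D.PiTemp} (hδYdd : δ ∈ D.GtpYdd) (hδ : ∀ x, ι (ι x) = δ * x * δ⁻¹)
    (T : D.ThetaKummerInput) (hη : E.etaDd = T.kummerTheta) (hcc : T.ConstCompat E.toKummerData)
    (hdeckFn : ∀ ε : D.PiTemp, ε ∈ D.GtpY → ε ∉ D.GtpYdd → ε • T.theta = T.const (-1) * T.theta) :
    ∃ τ₀ ∈ C.Huu, τ₀ ∈ D.GtpY ∧ transport cι hι.thm16i E.etaDd = ContH1.conj D.toTheta D.DeltaTheta τ₀ E.etaDd :=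
  C.exists_mem_Huu_mem_GtpY_transport_etaDd_eq_conj_of_invClauses hS h hC h15ii hδYdd hδ
    (fun _ _ hε₁ hε₂ => E.conj_etaDd_eq_of_deck_of_thetaKummer T hη hcc hdeckFn hε₁ hε₂)

end EtaleThetaData.DoubleUnderline

end ThetaSetting

end Literature.AnabelianGeometry.EtaleTheta

/-! ## §2. The binder of record `h14orbit` (abc-iut-L6 currency) FROM the class-level inversion data -/

namespace Literature.IUT.HodgeArakelov

open Literature.AnabelianGeometry.EtaleTheta (ContH1 ThetaSetting)
open Literature.AnabelianGeometry.EtaleTheta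
open EtaleThetaDataOfSetting CohomologySystemOfContH1
open _root_.Topology

namespace EtaleThetaDataOfSetting

variable {p : ℕ} [Fact p.Prime] {D : Literature.AnabelianGeometry.EtaleTheta.ThetaSetting p}
  {E : D.EtaleThetaData} {l : ℕ} (C : E.DoubleUnderline l)
  (ι : D.PiTemp ≃ₜ* D.PiTemp) (hι : C.Huu.map ι.toMulEquiv.toMonoidHom = C.Huu)
  (c : ThetaSetting.ThetaCompanion ι)

/-- **`h14orbit` (GAP row D-G-w4d010-2f) FROM THE CLASS-LEVEL INVERSION DATA** — shape VERBATIM that of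
`prop22_ii'_model_of_inversion_of_prop15_of_origin_orbit` (p457679) / `h14orbit_of_thetaKummer` (p465052): for an
`X̲̲`-choice `C` ((H1) `hchar`, `Sec2Hyps`), an INVERSION AUTOMORPHISM `ι` in abc-iut-L2-t1's sense (`IsInversionAut`) with
`ι(Π^tp_X̲̲) = Π^tp_X̲̲` and theta companion `c`, satisfying the inversion clause of [EtTh] Prop. 1.5 (iii) (`InvClauses`),
GRANTED `Compat` + Prop. 1.5 (ii), the pointedness clause (h_sq) `ι² = Ad(δ)` with `δ ∈ Π^tp_Ÿ`, and the class-level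
deck-sign clause for the deck transformations of `Ÿ̲̲ → Y̲̲`: the pair `(ι|_{Π^tp_X̲̲}, ι^Θ)` carries `η̈^Θ|_{Π^tp_Ÿ̲̲}` to
`τ₀ · η̈^Θ|_{Π^tp_Ÿ̲̲}` for some `τ₀ ∈ Π^tp_X̲̲ ∩ Π^tp_Y`. Proof: §1 + abc-iut-w5-d072's naturality
`autMap_comap_eq_comap_transport` + abc-iut-w4-d014's `ContH1.comap_conj`. [cite: MochizukiEtTh2009, Thm 1.6 (iii) p.24] -/
theorem h14orbit_of_invClauses [(PiYdd C).Normal] [D.GtpYdd.Normal] (hS : D.Sec2Hyps)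
    (hchar : PiYddCharacteristic C) (hιA : D.IsInversionAut ι) (hInv : ThetaSetting.InvClauses E hιA c)
    (hC : D.Compat) (h15ii : ThetaSetting.Prop15ii E.toKummerData hC)
    {δ : D.PiTemp} (hδYdd : δ ∈ D.GtpYdd) (hδ : ∀ x, ι (ι x) = δ * x * δ⁻¹)
    (hdeck : ∀ ε : Pi C, (ε : D.PiTemp) ∈ D.GtpY → (ε : D.PiTemp) ∉ D.GtpYdd →
      ContH1.conj D.toTheta D.DeltaTheta (ε : D.PiTemp) E.etaDd =
        D.inflTheta D.GtpYdd (E.kumYdd (E.toKddHat (-1))) * E.etaDd) :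
    ∃ τ₀ : Pi C, (τ₀ : D.PiTemp) ∈ D.GtpY ∧
      ContH1Aut.autMap (phi C) D.DeltaTheta (inversionAlpha C ι hι) c.thetaIso
        (thetaCompanion_phi C ι hι c) (thetaCompanion_mem_deltaTheta ι c)
        (symm_mem_inf_top (PiYdd C) (inversionAlpha C ι hι) (mem_PiYdd_iff_of_piYddCharacteristic C hchar _))
        (ContH1.comap D.toTheta D.DeltaTheta C.Huu.subtype continuous_subtype_val
          (map_subtype_piYdd_inf_le_GtpYdd C ⊤) E.etaDd) =
      ContH1.conj (phi C) D.DeltaTheta τ₀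
        (ContH1.comap D.toTheta D.DeltaTheta C.Huu.subtype continuous_subtype_val
          (map_subtype_piYdd_inf_le_GtpYdd C ⊤) E.etaDd) := by
  obtain ⟨τ₀, hτH, hτY, hT⟩ :=
    C.exists_mem_Huu_mem_GtpY_transport_etaDd_eq_conj_of_invClauses hS hInv hC h15ii hδYdd hδ
      (fun ε hεH hε₁ hε₂ => hdeck ⟨ε, hεH⟩ hε₁ hε₂)
  refine ⟨⟨τ₀, hτH⟩, hτY, ?_⟩
  rw [autMap_comap_eq_comap_transport C ι hι c hιA.thm16i (mem_PiYdd_iff_of_piYddCharacteristic C hchar _), hT]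
  exact ContH1.comap_conj D.toTheta D.DeltaTheta C.Huu.subtype continuous_subtype_val
    (map_subtype_piYdd_inf_le_GtpYdd C ⊤) (⟨τ₀, hτH⟩ : Pi C) E.etaDd

/-- **`h14orbit` from the [EtTh] Prop. 1.5 (iii) predicate `Prop15iiiInvAnchored` + ONE anchored cusp of `Ÿ` over the
component labelled `0` fixed by `ι`** («which fixes the irreducible component of the special fiber of `Y` labeled `0`»,
p. 23; «a cusp that is preserved by the inversion automorphism», proof of Thm. 1.6 (iii) p. 25 l. 34) — in place of
`InvClauses`. [cite: MochizukiEtTh2009, Prop 1.5 (iii) p.23] -/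
theorem h14orbit_of_prop15iiiInvAnchored [(PiYdd C).Normal] [D.GtpYdd.Normal] (hS : D.Sec2Hyps)
    (hchar : PiYddCharacteristic C) (hιA : D.IsInversionAut ι) (h15inv : D.Prop15iiiInvAnchored E)
    (y : ThetaSetting.CuspidalPointDd E.toKummerData) (hyA : y.IsAnchored) (hy0 : y.IsOnLabelZero)
    (hyfix : D.FixesCuspBelow ι y)
    (hC : D.Compat) (h15ii : ThetaSetting.Prop15ii E.toKummerData hC)
    {δ : D.PiTemp} (hδYdd : δ ∈ D.GtpYdd) (hδ : ∀ x, ι (ι x) = δ * x * δ⁻¹)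
    (hdeck : ∀ ε : Pi C, (ε : D.PiTemp) ∈ D.GtpY → (ε : D.PiTemp) ∉ D.GtpYdd →
      ContH1.conj D.toTheta D.DeltaTheta (ε : D.PiTemp) E.etaDd =
        D.inflTheta D.GtpYdd (E.kumYdd (E.toKddHat (-1))) * E.etaDd) :
    ∃ τ₀ : Pi C, (τ₀ : D.PiTemp) ∈ D.GtpY ∧
      ContH1Aut.autMap (phi C) D.DeltaTheta (inversionAlpha C ι hι) c.thetaIso
        (thetaCompanion_phi C ι hι c) (thetaCompanion_mem_deltaTheta ι c)
        (symm_mem_inf_top (PiYdd C) (inversionAlpha C ι hι) (mem_PiYdd_iff_of_piYddCharacteristic C hchar _))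
        (ContH1.comap D.toTheta D.DeltaTheta C.Huu.subtype continuous_subtype_val
          (map_subtype_piYdd_inf_le_GtpYdd C ⊤) E.etaDd) =
      ContH1.conj (phi C) D.DeltaTheta τ₀
        (ContH1.comap D.toTheta D.DeltaTheta C.Huu.subtype continuous_subtype_val
          (map_subtype_piYdd_inf_le_GtpYdd C ⊤) E.etaDd) :=
  h14orbit_of_invClauses C ι hι c hS hchar hιA (h15inv ι hιA c y hyA hy0 hyfix) hC h15ii hδYdd hδ hdeck

/-! ## §3. IUTchII:Prop2.2(ii)′ at the model with the class-level `ι`-binder GONE -/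

/-- **IUTchII:Prop2.2(ii)′ at the model `Π_v := Π^tp_X̲̲` — `μ_{2l}`-clause closer with NO class-level statement about
`ι` as a binder** (kurims p. 66): `Prop22_ii' Dec` at `D := etaleThetaDataOfSetting′` GIVEN EXACTLY the model data
(`C`, `hC`, `hS`, (H1) `hchar`, `S`, `eS`, `hl`, `Dec`); the inversion as an [EtTh] inversion automorphism
{`IsInversionAut ι`, `ι(Π^tp_X̲̲) = Π^tp_X̲̲`, theta companion `c`, the inversion clause `InvClauses` of Prop. 1.5 (iii),
pointedness (h_sq) `ι² = Ad(δ)` with `δ ∈ Π^tp_Ÿ̲̲`}; the class-level deck-sign clause for the deck transformations of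
`Ÿ̲̲ → Y̲̲` ([EtTh] Prop. 1.4 (ii) «`Θ̈(−Ü) = −Θ̈(Ü)`»); and the named facts `IsEtThOrigin` (F-2498), `Prop15iii` (F-0591),
`Prop15ii` (F-2503). The `toLZ`-generator, the deck element, `hZ`, `hβ` and `h14orbit` of
`prop22_ii'_model_of_inversion_of_prop15_of_origin_orbit` (p457679) are THEOREMS here (abc-iut-w5-d072's junction
`prop22_ii'_model_of_transport_conj_of_prop15_of_origin`, p457878, fed by §1).
[claim: Mochizuki2012, status: disputed] (IUTchII §2 Prop 2.2 (ii), kurims p.66) -/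
theorem prop22_ii'_model_of_invClauses_of_prop15_of_origin
    (hι : C.Huu.map ι.toMulEquiv.toMonoidHom = C.Huu) [(PiYdd C).Normal] [D.GtpYdd.Normal]
    (hC : D.Compat) (hS : D.Sec2Hyps) (hchar : PiYddCharacteristic C) (S : BadPlaceSetting.{0})
    (eS : (Pi C) ≃ₜ* S.PiX) (hl : S.l = l) {T₀ : TemperedCoverings S (Pi C)}
    (Dec : SubgraphDecomposition S T₀ (etaleThetaDataOfSetting' C hC hS hchar S.toThetaSetting eS hl))
    -- the inversion automorphism of [EtTh] Prop. 1.5 (iii), pointed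
    (hιA : D.IsInversionAut ι) (hInv : ThetaSetting.InvClauses E hιA c)
    (δ : Pi C) (hδYdd : (δ : D.PiTemp) ∈ D.GtpYdd)
    (hιι : ∀ x : D.PiTemp, ι (ι x) = (δ : D.PiTemp) * x * (δ : D.PiTemp)⁻¹)
    -- the class-level deck-sign clause ([EtTh] Prop. 1.4 (ii) on classes)
    (hdeck : ∀ ε : Pi C, (ε : D.PiTemp) ∈ D.GtpY → (ε : D.PiTemp) ∉ D.GtpYdd →
      ContH1.conj D.toTheta D.DeltaTheta (ε : D.PiTemp) E.etaDd =
        D.inflTheta D.GtpYdd (E.kumYdd (E.toKddHat (-1))) * E.etaDd)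
    -- the [EtTh] §1 named facts
    (hO : D.IsEtThOrigin) (h15 : ThetaSetting.Prop15iii E hC) (h15ii : ThetaSetting.Prop15ii E.toKummerData hC) :
    Prop22_ii' Dec := by
  -- a `toLZ`-generator and a deck element of `Ÿ̲̲ → Y̲̲` inside `Π^tp_X̲̲` (this lineage's `exists_translation_generators`)
  obtain ⟨γ, ε, hγ, hε₁, hε₂⟩ := exists_translation_generators C hS
  -- `ι^Θ` fixes `Δ_Θ` pointwise (abc-iut-L2-t1 / abc-iut-w4-d014), so the `l·Δ_Θ`-congruence `hβ` is trivial
  have hβ : ∀ a : D.GtpTheta, a ∈ D.DeltaTheta → c.thetaIso a * a⁻¹ ∈ D.lDeltaTheta l := by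
    intro a ha
    have hfix : c.thetaIso a = a := hιA.thetaIso_apply_eq_self c ha
    rw [hfix, mul_inv_cancel]
    exact one_mem _
  -- the class-level orbit statement in abc-iut-L2-t1's transport currency, from §1
  obtain ⟨τ₀, hτH, hτY, hT⟩ :=
    C.exists_mem_Huu_mem_GtpY_transport_etaDd_eq_conj_of_invClauses hS hInv hC h15ii hδYdd hιι
      (fun e heH he₁ he₂ => hdeck ⟨e, heH⟩ he₁ he₂)
  exact prop22_ii'_model_of_transport_conj_of_prop15_of_origin C ι c hι hC hS hchar S eS hl Dec hιA.thm16i γ ε hγ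
    hε₁ hε₂ (hιA.toZ_apply _) δ (fun x => hιι x) hβ ⟨⟨τ₀, hτH⟩, hτY, hT⟩ hO h15 h15ii

/-- **IUTchII:Prop2.2(ii)′ at the model from the [EtTh] Prop. 1.5 (iii) predicate `Prop15iiiInvAnchored`** + ONE anchored
cusp of `Ÿ` over the component labelled `0` fixed by `ι` (in place of `InvClauses`); otherwise as
`prop22_ii'_model_of_invClauses_of_prop15_of_origin`. [claim: Mochizuki2012, status: disputed] (IUTchII §2 Prop 2.2 (ii), kurims p.66) -/
theorem prop22_ii'_model_of_prop15iiiInvAnchored_of_prop15_of_origin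
    (hι : C.Huu.map ι.toMulEquiv.toMonoidHom = C.Huu) (c : ThetaSetting.ThetaCompanion ι)
    [(PiYdd C).Normal] [D.GtpYdd.Normal] (hC : D.Compat) (hS : D.Sec2Hyps) (hchar : PiYddCharacteristic C) (S : BadPlaceSetting.{0})
    (eS : (Pi C) ≃ₜ* S.PiX) (hl : S.l = l) {T₀ : TemperedCoverings S (Pi C)}
    (Dec : SubgraphDecomposition S T₀ (etaleThetaDataOfSetting' C hC hS hchar S.toThetaSetting eS hl))
    (hιA : D.IsInversionAut ι) (h15inv : D.Prop15iiiInvAnchored E)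
    (y : ThetaSetting.CuspidalPointDd E.toKummerData) (hyA : y.IsAnchored) (hy0 : y.IsOnLabelZero)
    (hyfix : D.FixesCuspBelow ι y)
    (δ : Pi C) (hδYdd : (δ : D.PiTemp) ∈ D.GtpYdd)
    (hιι : ∀ x : D.PiTemp, ι (ι x) = (δ : D.PiTemp) * x * (δ : D.PiTemp)⁻¹)
    (hdeck : ∀ ε : Pi C, (ε : D.PiTemp) ∈ D.GtpY → (ε : D.PiTemp) ∉ D.GtpYdd →
      ContH1.conj D.toTheta D.DeltaTheta (ε : D.PiTemp) E.etaDd =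
        D.inflTheta D.GtpYdd (E.kumYdd (E.toKddHat (-1))) * E.etaDd)
    (hO : D.IsEtThOrigin) (h15 : ThetaSetting.Prop15iii E hC) (h15ii : ThetaSetting.Prop15ii E.toKummerData hC) :
    Prop22_ii' Dec :=
  prop22_ii'_model_of_invClauses_of_prop15_of_origin C ι c hι hC hS hchar S eS hl Dec hιA
    (h15inv ι hιA c y hyA hy0 hyfix) δ hδYdd hιι hdeck hO h15 h15ii

/-- **IUTchII:Prop2.2(ii)′ at the model with the deck-sign clause FED FROM THE FUNCTION-LEVEL DECK IDENTITY** of [EtTh]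
Prop. 1.4 (ii) («`Θ̈(−Ü) = −Θ̈(Ü)`» on a theta-Kummer input `T` with `η̈^Θ = κ(Θ̈)` and `ConstCompat`, abc-iut-L2-t12 /
abc-iut-w5-d125 vocabulary; no statement about `ι` acting on functions); otherwise as
`prop22_ii'_model_of_invClauses_of_prop15_of_origin`. [claim: Mochizuki2012, status: disputed] (IUTchII §2 Prop 2.2 (ii), kurims p.66) -/
theorem prop22_ii'_model_of_invClauses_of_thetaKummerDeck_of_prop15_of_origin
    (hι : C.Huu.map ι.toMulEquiv.toMonoidHom = C.Huu) [(PiYdd C).Normal] [D.GtpYdd.Normal]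
    (hC : D.Compat) (hS : D.Sec2Hyps) (hchar : PiYddCharacteristic C) (S : BadPlaceSetting.{0})
    (eS : (Pi C) ≃ₜ* S.PiX) (hl : S.l = l) {T₀ : TemperedCoverings S (Pi C)}
    (Dec : SubgraphDecomposition S T₀ (etaleThetaDataOfSetting' C hC hS hchar S.toThetaSetting eS hl))
    (hιA : D.IsInversionAut ι) (hInv : ThetaSetting.InvClauses E hιA c)
    (δ : Pi C) (hδYdd : (δ : D.PiTemp) ∈ D.GtpYdd)
    (hιι : ∀ x : D.PiTemp, ι (ι x) = (δ : D.PiTemp) * x * (δ : D.PiTemp)⁻¹)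
    (T : D.ThetaKummerInput) (hη : E.etaDd = T.kummerTheta) (hcc : T.ConstCompat E.toKummerData)
    (hdeckFn : ∀ ε : D.PiTemp, ε ∈ D.GtpY → ε ∉ D.GtpYdd → ε • T.theta = T.const (-1) * T.theta)
    (hO : D.IsEtThOrigin) (h15 : ThetaSetting.Prop15iii E hC) (h15ii : ThetaSetting.Prop15ii E.toKummerData hC) :
    Prop22_ii' Dec :=
  prop22_ii'_model_of_invClauses_of_prop15_of_origin C ι c hι hC hS hchar S eS hl Dec hιA hInv δ hδYdd hιι
    (fun _ hε₁ hε₂ => E.conj_etaDd_eq_of_deck_of_thetaKummer T hη hcc hdeckFn hε₁ hε₂) hO h15 h15ii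

end EtaleThetaDataOfSetting

end Literature.IUT.HodgeArakelov

end
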